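import Summits.ValiantsHypothesis.ValiantsHypothesis.Theorems.SymPencilPerFourCrossSixQuadratic

/-!
# Route `SymPencil` — the space `W₂ = row 0 ⊕ span(E₁₀, E₁₁)` at size `27`, III: classification
# of the `b`-lever spaces (`--supports` stmt-ValiantsHypothesis-5674 `SdcSuperquadratic`;
# cell `(10,6,6)`; rung currency only, nothing here bears on `VP ≠ VNP`)

`w2_classify_b`: in complement coordinates `u = (r, c)` of `W₂` (`r (0,j) = x_{2,j+1}`,
`r (1,j) = x_{3,j+1}`, `c = (x₁₂,x₁₃,x₂₀,x₃₀)`), a subspace `S` of dimension `≥ 7` on which the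
three permanental minors `Q_{jj'} = r₀ⱼ r₁ⱼ' + r₀ⱼ' r₁ⱼ` (`j ≠ j'`) vanish satisfies `r₀ ≡ 0` on
`S` or `r₁ ≡ 0` on `S` (i.e. `S = Y^±` of `Cruxes/SdcSuperquadratic/PENCIL-CROSS-27.md` rev 6
§W₂ (b)).  Proof: the columns `c_j(u) = (r₀ⱼ, r₁ⱼ) ∈ k²`; a column map onto `k²` would force a
vector of `S ∩ ker c_j` outside `{r = 0}` to have its other two columns zero (polar identities)
— so every `c_j(S)` is a line `k l_j`; counting gives all three lines nonzero, the polar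
identities make them pairwise orthogonal for `φ(l,l') = l₀l'₁ + l'₀l₁`, whence all `l_j` lie on
the same isotropic axis.  Plus the bookkeeping identity `finrank_eq_finrank_map_add_finrank_inf_ker`.
No definitions, no named facts. [folklore]
-/

noncomputable section

-- single-conjunct layout: Sub = Summit, duplicated namespace component intended
set_option linter.dupNamespace false

namespace Summit.ValiantsHypothesis.ValiantsHypothesis.Theorems.SymPencilPerFourW2Columns

open Matrix Module

universe u

variable {k : Type u} [Field k]

/-- Bookkeeping: `dim S = dim f(S) + dim (S ∩ ker f)`. [folklore] -/
theorem finrank_eq_finrank_map_add_finrank_inf_ker {M N : Type*} [AddCommGroup M] [Module k M]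
    [AddCommGroup N] [Module k N] [FiniteDimensional k M] (f : M →ₗ[k] N) (S : Submodule k M) :
    finrank k S = finrank k (S.map f) + finrank k (S ⊓ LinearMap.ker f : Submodule k M) := by
  have h := LinearMap.finrank_range_add_finrank_ker (f.domRestrict S)
  rw [LinearMap.range_domRestrict, LinearMap.ker_domRestrict,
    (Submodule.equivMapOfInjective S.subtype S.injective_subtype _).finrank_eq,
    Submodule.map_comap_subtype] at h
  omega

/-- Three nonzero vectors of `k²`, pairwise orthogonal for `φ(l,l') = l₀l'₁ + l'₀l₁`, lie on a
common isotropic axis. [folklore] -/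
theorem axis_of_pairwise_orthogonal [CharZero k] (l : Fin 3 → Fin 2 → k) (hl : ∀ j, l j ≠ 0)
    (hφ : ∀ j j', j ≠ j' → l j 0 * l j' 1 + l j' 0 * l j 1 = 0) :
    (∀ j, l j 0 = 0) ∨ (∀ j, l j 1 = 0) := by
  have hl' : ∀ j, ¬ (l j 0 = 0 ∧ l j 1 = 0) := fun j h => hl j (by
    funext i; fin_cases i
    · exact h.1
    · exact h.2)
  have e01 := hφ 0 1 (by decide)
  have e02 := hφ 0 2 (by decide)
  have e12 := hφ 1 2 (by decide)
  by_cases hp : l 0 0 = 0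
  · left
    have hq0 : l 0 1 ≠ 0 := fun h => hl' 0 ⟨hp, h⟩
    rw [hp, zero_mul, zero_add] at e01 e02
    have h1 : l 1 0 = 0 := (mul_eq_zero.1 e01).resolve_right hq0
    have h2 : l 2 0 = 0 := (mul_eq_zero.1 e02).resolve_right hq0
    intro j; fin_cases j
    · exact hp
    · exact h1
    · exact h2
  · right
    have hq0 : l 0 1 = 0 := by
      by_contra hq
      have h12 : l 1 0 * l 2 0 = 0 := by
        have h : l 0 0 * l 0 0 * (l 1 0 * l 2 1 + l 2 0 * l 1 1) +
            2 * l 0 0 * l 0 1 * (l 1 0 * l 2 0) = 0 := by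
          linear_combination (l 2 0 * l 0 0) * e01 + (l 1 0 * l 0 0) * e02
        rw [e12, mul_zero, zero_add] at h
        have h2 : (2 * l 0 0 * l 0 1) ≠ 0 := mul_ne_zero (mul_ne_zero two_ne_zero hp) hq
        exact (mul_eq_zero.1 h).resolve_left h2
      rcases mul_eq_zero.1 h12 with h1 | h2
      · rw [h1, zero_mul, add_zero] at e01
        exact hl' 1 ⟨h1, (mul_eq_zero.1 e01).resolve_left hp⟩
      · rw [h2, zero_mul, add_zero] at e02
        exact hl' 2 ⟨h2, (mul_eq_zero.1 e02).resolve_left hp⟩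
    have h1 : l 1 1 = 0 := by
      rw [hq0, mul_zero, add_zero] at e01
      exact (mul_eq_zero.1 e01).resolve_left hp
    have h2 : l 2 1 = 0 := by
      rw [hq0, mul_zero, add_zero] at e02
      exact (mul_eq_zero.1 e02).resolve_left hp
    intro j; fin_cases j
    · exact hq0
    · exact h1
    · exact h2

/-- **Classification of the `b`-lever spaces of `W₂`** (see the module docstring). [folklore] -/
theorem w2_classify_b [CharZero k] (S : Submodule k ((Fin 2 × Fin 3 → k) × (Fin 4 → k)))
    (hQ : ∀ u ∈ S, ∀ j j' : Fin 3, j ≠ j' →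
      u.1 (0, j) * u.1 (1, j') + u.1 (0, j') * u.1 (1, j) = 0)
    (h7 : 7 ≤ finrank k S) :
    (∀ u ∈ S, ∀ j : Fin 3, u.1 (0, j) = 0) ∨ (∀ u ∈ S, ∀ j : Fin 3, u.1 (1, j) = 0) := by
  classical
  -- column maps
  let col : Fin 3 → (((Fin 2 × Fin 3 → k) × (Fin 4 → k)) →ₗ[k] (Fin 2 → k)) := fun j =>
    LinearMap.funLeft k k (fun i : Fin 2 => ((i, j) : Fin 2 × Fin 3)) ∘ₗ
      LinearMap.fst k (Fin 2 × Fin 3 → k) (Fin 4 → k)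
  have hcol : ∀ j u i, col j u i = u.1 (i, j) := fun _ _ _ => rfl
  -- polar identity
  have hpol : ∀ u ∈ S, ∀ w ∈ S, ∀ j j' : Fin 3, j ≠ j' →
      u.1 (0, j) * w.1 (1, j') + w.1 (0, j) * u.1 (1, j') + u.1 (0, j') * w.1 (1, j) +
        w.1 (0, j') * u.1 (1, j) = 0 := by
    intro u hu w hw j j' hjj'
    have h := hQ _ (S.add_mem hu hw) j j' hjj'
    simp only [Prod.fst_add, Pi.add_apply] at h
    linear_combination h - hQ u hu j j' hjj' - hQ w hw j j' hjj'
  have h2 : finrank k (Fin 2 → k) = 2 := by simp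
  -- a subspace all of whose columns vanish has dimension `≤ 4`
  have hsmall : ∀ S' : Submodule k ((Fin 2 × Fin 3 → k) × (Fin 4 → k)),
      (∀ s ∈ S', ∀ j' i, s.1 (i, j') = 0) → finrank k S' ≤ 4 := by
    intro S' hS'
    have hb := finrank_eq_finrank_map_add_finrank_inf_ker (LinearMap.snd k _ (Fin 4 → k)) S'
    have hbot : (S' ⊓ LinearMap.ker (LinearMap.snd k _ (Fin 4 → k)) : Submodule k _) = ⊥ := by
      rw [Submodule.eq_bot_iff]
      intro s hs
      obtain ⟨hs0, hs2⟩ := Submodule.mem_inf.1 hs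
      rw [LinearMap.mem_ker, LinearMap.snd_apply] at hs2
      refine Prod.ext ?_ hs2
      funext p
      obtain ⟨i, j'⟩ := p
      rw [Prod.fst_zero, Pi.zero_apply]
      exact hS' s hs0 j' i
    have hm : finrank k (S'.map (LinearMap.snd k _ (Fin 4 → k))) ≤ 4 := by
      have := Submodule.finrank_le (S'.map (LinearMap.snd k _ (Fin 4 → k)))
      simpa using this
    rw [hbot, finrank_bot] at hb
    omega
  -- Step 1: every column image has dimension `≤ 1`
  have hstep1 : ∀ j, finrank k (S.map (col j)) ≤ 1 := by
    intro j
    by_contra hlt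
    push Not at hlt
    have hle2 : finrank k (S.map (col j)) ≤ 2 := by
      have := Submodule.finrank_le (S.map (col j)); rwa [h2] at this
    have htop : S.map (col j) = ⊤ :=
      Submodule.eq_top_of_finrank_eq (by rw [h2]; omega)
    have hmem : ∀ v : Fin 2 → k, ∃ y ∈ S, col j y = v := fun v => by
      have hv : v ∈ S.map (col j) := by rw [htop]; exact Submodule.mem_top
      obtain ⟨y, hy, e⟩ := hv
      exact ⟨y, hy, e⟩
    obtain ⟨y₁, hy₁, e₁⟩ := hmem (Pi.single 0 1)
    obtain ⟨y₂, hy₂, e₂⟩ := hmem (Pi.single 1 1)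
    have hy₁0 : y₁.1 (0, j) = 1 := by have := congr_fun e₁ 0; simpa [hcol] using this
    have hy₁1 : y₁.1 (1, j) = 0 := by have := congr_fun e₁ 1; simpa [hcol] using this
    have hy₂0 : y₂.1 (0, j) = 0 := by have := congr_fun e₂ 0; simpa [hcol] using this
    have hy₂1 : y₂.1 (1, j) = 1 := by have := congr_fun e₂ 1; simpa [hcol] using this
    have h5 : 5 ≤ finrank k (S ⊓ LinearMap.ker (col j) : Submodule k _) := by
      have hb := finrank_eq_finrank_map_add_finrank_inf_ker (col j) S
      omega
    have hzero : ∀ s ∈ (S ⊓ LinearMap.ker (col j) : Submodule k _), ∀ j' i, s.1 (i, j') = 0 := by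
      intro s hs j'
      obtain ⟨hsS, hsK⟩ := Submodule.mem_inf.1 hs
      rw [LinearMap.mem_ker] at hsK
      have hs0 : s.1 (0, j) = 0 := by have := congr_fun hsK 0; simpa [hcol] using this
      have hs1 : s.1 (1, j) = 0 := by have := congr_fun hsK 1; simpa [hcol] using this
      by_cases hj' : j' = j
      · subst hj'
        intro i; fin_cases i
        · exact hs0
        · exact hs1
      · have p1 := hpol s hsS y₁ hy₁ j j' (Ne.symm hj')
        have p2 := hpol s hsS y₂ hy₂ j j' (Ne.symm hj')
        rw [hs0, hs1, hy₁0, hy₁1] at p1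
        rw [hs0, hs1, hy₂0, hy₂1] at p2
        have a1 : s.1 (1, j') = 0 := by linear_combination p1
        have a0 : s.1 (0, j') = 0 := by linear_combination p2
        intro i; fin_cases i
        · exact a0
        · exact a1
    have h4 := hsmall _ hzero
    omega
  -- Step 2: every column image is a line
  have hchain : finrank k S ≤ finrank k (S.map (col 0)) + finrank k (S.map (col 1)) +
      finrank k (S.map (col 2)) + 4 := by
    have b0 := finrank_eq_finrank_map_add_finrank_inf_ker (col 0) S
    have b1 := finrank_eq_finrank_map_add_finrank_inf_ker (col 1)
      (S ⊓ LinearMap.ker (col 0) : Submodule k _)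
    have b2 := finrank_eq_finrank_map_add_finrank_inf_ker (col 2)
      ((S ⊓ LinearMap.ker (col 0)) ⊓ LinearMap.ker (col 1) : Submodule k _)
    have m1 : finrank k ((S ⊓ LinearMap.ker (col 0) : Submodule k _).map (col 1)) ≤
        finrank k (S.map (col 1)) :=
      Submodule.finrank_mono (Submodule.map_mono inf_le_left)
    have m2 : finrank k (((S ⊓ LinearMap.ker (col 0)) ⊓ LinearMap.ker (col 1) :
        Submodule k _).map (col 2)) ≤ finrank k (S.map (col 2)) :=
      Submodule.finrank_mono (Submodule.map_mono (inf_le_left.trans inf_le_left))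
    have h3 : finrank k (((S ⊓ LinearMap.ker (col 0)) ⊓ LinearMap.ker (col 1) ⊓
        LinearMap.ker (col 2) : Submodule k _)) ≤ 4 := by
      refine hsmall _ fun s hs j' i => ?_
      obtain ⟨hs01, hs2⟩ := Submodule.mem_inf.1 hs
      obtain ⟨hs0', hs1⟩ := Submodule.mem_inf.1 hs01
      obtain ⟨-, hs0⟩ := Submodule.mem_inf.1 hs0'
      rw [LinearMap.mem_ker] at hs0 hs1 hs2
      fin_cases j'
      · have := congr_fun hs0 i; simpa [hcol] using this
      · have := congr_fun hs1 i; simpa [hcol] using this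
      · have := congr_fun hs2 i; simpa [hcol] using this
    omega
  have hst0 := hstep1 0
  have hst1 := hstep1 1
  have hst2 := hstep1 2
  have hone0 : 1 ≤ finrank k (S.map (col 0)) := by omega
  have hone1 : 1 ≤ finrank k (S.map (col 1)) := by omega
  have hone2 : 1 ≤ finrank k (S.map (col 2)) := by omega
  have hone : ∀ j, 1 ≤ finrank k (S.map (col j)) := by
    intro j; fin_cases j
    · exact hone0
    · exact hone1
    · exact hone2
  -- generators of the lines
  have hgen : ∀ j, ∃ l : Fin 2 → k, l ≠ 0 ∧ (∃ u ∈ S, col j u = l) ∧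
      ∀ w ∈ S, ∃ c : k, c • l = col j w := by
    intro j
    have hne : S.map (col j) ≠ ⊥ := fun h => by
      have := hone j; rw [h, finrank_bot] at this; omega
    obtain ⟨l, hl, hl0⟩ := Submodule.exists_mem_ne_zero_of_ne_bot hne
    obtain ⟨u, hu, rfl⟩ := hl
    refine ⟨col j u, hl0, ⟨u, hu, rfl⟩, fun w hw => ?_⟩
    have h1 : finrank k (S.map (col j)) = 1 := le_antisymm (hstep1 j) (hone j)
    have hl0' : (⟨col j u, ⟨u, hu, rfl⟩⟩ : S.map (col j)) ≠ 0 := by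
      intro h
      apply hl0
      simpa using congrArg Subtype.val h
    obtain ⟨c, hc⟩ := (finrank_eq_one_iff_of_nonzero' _ hl0').1 h1 ⟨col j w, ⟨w, hw, rfl⟩⟩
    exact ⟨c, by simpa using congrArg Subtype.val hc⟩
  choose l hl0 hlu hlgen using hgen
  -- Step 3: the lines are pairwise `φ`-orthogonal
  have hφ : ∀ j j', j ≠ j' → l j 0 * l j' 1 + l j' 0 * l j 1 = 0 := by
    intro j j' hjj'
    obtain ⟨u, hu, hcu⟩ := hlu j
    obtain ⟨w, hw, hcw⟩ := hlu j'
    obtain ⟨c₁, hc₁⟩ := hlgen j' u hu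
    obtain ⟨c₂, hc₂⟩ := hlgen j w hw
    have u0 : u.1 (0, j) = l j 0 := by rw [← hcol, hcu]
    have u1 : u.1 (1, j) = l j 1 := by rw [← hcol, hcu]
    have w0 : w.1 (0, j') = l j' 0 := by rw [← hcol, hcw]
    have w1 : w.1 (1, j') = l j' 1 := by rw [← hcol, hcw]
    have u0' : u.1 (0, j') = c₁ * l j' 0 := by
      rw [← hcol j' u 0, ← hc₁, Pi.smul_apply, smul_eq_mul]
    have u1' : u.1 (1, j') = c₁ * l j' 1 := by
      rw [← hcol j' u 1, ← hc₁, Pi.smul_apply, smul_eq_mul]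
    have w0' : w.1 (0, j) = c₂ * l j 0 := by
      rw [← hcol j w 0, ← hc₂, Pi.smul_apply, smul_eq_mul]
    have w1' : w.1 (1, j) = c₂ * l j 1 := by
      rw [← hcol j w 1, ← hc₂, Pi.smul_apply, smul_eq_mul]
    have q1 := hQ u hu j j' hjj'
    have q2 := hQ w hw j j' hjj'
    have p := hpol u hu w hw j j' hjj'
    rw [u0, u1, u0', u1'] at q1
    rw [w0, w1, w0', w1'] at q2
    rw [u0, u1, u0', u1', w0, w1, w0', w1'] at p
    by_contra hne
    have hc1 : c₁ = 0 := by
      have h : c₁ * (l j 0 * l j' 1 + l j' 0 * l j 1) = 0 := by linear_combination q1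
      exact (mul_eq_zero.1 h).resolve_right hne
    have hc2 : c₂ = 0 := by
      have h : c₂ * (l j 0 * l j' 1 + l j' 0 * l j 1) = 0 := by linear_combination q2
      exact (mul_eq_zero.1 h).resolve_right hne
    rw [hc1, hc2] at p
    apply hne
    linear_combination p
  -- Step 4: common isotropic axis
  rcases axis_of_pairwise_orthogonal l hl0 hφ with h | h
  · left
    intro u hu j
    obtain ⟨c, hc⟩ := hlgen j u hu
    rw [← hcol j u 0, ← hc, Pi.smul_apply, smul_eq_mul, h j, mul_zero]
  · right
    intro u hu j
    obtain ⟨c, hc⟩ := hlgen j u hu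
    rw [← hcol j u 1, ← hc, Pi.smul_apply, smul_eq_mul, h j, mul_zero]

end Summit.ValiantsHypothesis.ValiantsHypothesis.Theorems.SymPencilPerFourW2Columns

end
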